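import Mathlib
import Summits.ValiantsHypothesis.ValiantsHypothesis.Theorems.LacunarySymmetroidMatrixDescartesRegimeWindowsToolkit

/-!
# `MatrixDescartes` (stmt-ValiantsHypothesis-18050) — the N-WINDOW ENGINE: `Z₊ ≤ N·m` whenever `(0,∞)` is covered by
# `N` scale windows on each of which the pencil is positively normalisable to a Loewner-monotone family

HONEST FRAMING.  Cell `pub-symmetroid`, seat `val-sym-mdr-p2` (gen 4); helper file `--supports` the crux
`Theses.LacunarySymmetroid.MatrixDescartes`.  Root-counting ENGINE (the general form of `twoWindows_posRoots_le` /
`threeWindows_posRoots_le`); nothing here bears on the crux in general, on `stub_twoSided`, on `DoorA26` / `DoorA34`,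
or on `VP ≠ VNP`.

THE ENGINE (`manyWindows_posRoots_le`).  `F = ∑ₗ X^{dₗ} Sₗ` with real symmetric `ι × ι` letters; breakpoints
`0 = x₀ < x₁ ≤ x₂ ≤ ⋯ ≤ x_{N−1}` (`x` monotone, `xⱼ > 0` for `j ≥ 1`), windows `W₀ = (0, x₁]`, `Wⱼ = [xⱼ, x_{j+1}]`,
`W_{N−1} = [x_{N−1}, ∞)` (for `N = 1` the single window is `(0,∞)`).  If on EVERY window some positive weight `wⱼ` makes
`u ↦ wⱼ(u)⁻¹·F(u)` Loewner-monotone (non-decreasing OR non-increasing, per window), then `det F` has at most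
`N·card ι` distinct positive zeros.  Proof: the half-open windows `(0,x₁)`, `[xⱼ, x_{j+1})`, `[x_{N−1},∞)` partition
`(0,∞)`; on each, `RegimeWindows.posRoots_window_le` (clamped family + inertia chain; the non-increasing case through
`−F`) gives `≤ card ι` roots; union bound.  Combined with the dominated-window lemmas (`dominatedWindow_mono`,
`…_left`, `…_right`: monotonicity of `F/x^{d_π}` on a window from dominance of the adjacent blocks at its endpoints)
this is the kernel form of «a semidefinite sign word with `α` alternations whose sign boundaries dominate a covering
family of `α` windows has `Z₊ ≤ α·card ι`» — the Cameron–Psarrakos count [CameronPsarrakos2019, (6)] under dominance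
(`α = 1`: `oneAlternation`; `α = 2`: `dominantMiddle`).
[folklore] Mathlib + tree lemmas; axioms `propext`, `Classical.choice`, `Quot.sound`.
-/

-- layout Summits/ValiantsHypothesis/ValiantsHypothesis forces the duplicated namespace component
set_option linter.dupNamespace false

namespace Summit.ValiantsHypothesis.ValiantsHypothesis.Theorems.LacunarySymmetroidMatrixDescartes

open Polynomial Matrix Finset
open scoped BigOperators

namespace ManyWindows

variable {K : ℕ}

/-- The closed monotonicity domain of window `j` — `{t | 0 < t ∧ x j ≤ t ∧ (j + 1 < N → t ≤ x (j + 1))}` — is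
order-connected. [folklore] -/
theorem window_ordConnected (N : ℕ) (x : ℕ → ℝ) (j : ℕ) :
    ({t : ℝ | 0 < t ∧ x j ≤ t ∧ (j + 1 < N → t ≤ x (j + 1))} : Set ℝ).OrdConnected := by
  refine ⟨fun a ha b hb c hc => ?_⟩
  exact ⟨ha.1.trans_le hc.1, ha.2.1.trans hc.1, fun h => hc.2.trans (hb.2.2 h)⟩

/-- The clamp `u ↦ max (x j) (min u (x (j+1)))` (no upper clamp on the last window) is monotone. [folklore] -/
theorem clamp_mono (N : ℕ) (x : ℕ → ℝ) (j : ℕ) :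
    Monotone (fun u : ℝ => max (x j) (if j + 1 < N then min u (x (j + 1)) else u)) := by
  intro a b hab
  refine max_le_max le_rfl ?_
  split_ifs
  · exact min_le_min hab le_rfl
  · exact hab

/-- The clamp lands in the window for every `u > 0`. [folklore] -/
theorem clamp_mem (N : ℕ) (x : ℕ → ℝ) (hxmono : Monotone x) (hxpos : ∀ j, 1 ≤ j → 0 < x j) (j : ℕ)
    {u : ℝ} (hu : 0 < u) :
    max (x j) (if j + 1 < N then min u (x (j + 1)) else u)
      ∈ ({t : ℝ | 0 < t ∧ x j ≤ t ∧ (j + 1 < N → t ≤ x (j + 1))} : Set ℝ) := by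
  refine ⟨?_, le_max_left _ _, fun h => ?_⟩
  · refine lt_of_lt_of_le ?_ (le_max_right _ _)
    split_ifs with h
    · exact lt_min hu (hxpos (j + 1) (by omega))
    · exact hu
  · rw [if_pos h]
    exact max_le (hxmono (Nat.le_succ j)) (min_le_right _ _)

/-- A designated point stays strictly below the clamp of every later time. [folklore] -/
theorem lt_clamp (N : ℕ) (x : ℕ → ℝ) (j : ℕ) {t s : ℝ}
    (ht : 0 < t ∧ x j ≤ t ∧ (j + 1 < N → t < x (j + 1))) (hts : t < s) :
    t < max (x j) (if j + 1 < N then min s (x (j + 1)) else s) := by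
  refine lt_of_lt_of_le ?_ (le_max_right _ _)
  split_ifs with h
  · exact lt_min hts (ht.2.2 h)
  · exact hts

/-- The clamp fixes designated points. [folklore] -/
theorem clamp_fix (N : ℕ) (x : ℕ → ℝ) (j : ℕ) {t : ℝ}
    (ht : 0 < t ∧ x j ≤ t ∧ (j + 1 < N → t < x (j + 1))) :
    max (x j) (if j + 1 < N then min t (x (j + 1)) else t) = t := by
  have h2 : (if j + 1 < N then min t (x (j + 1)) else t) = t := by
    split_ifs with h
    · exact min_eq_left (ht.2.2 h).le
    · rfl
  rw [h2]
  exact max_eq_right ht.2.1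

/-- **One window**: if `F/w` is Loewner-monotone (either direction) on window `j`, then `det F` has at most `card ι`
distinct roots in its designated half-open region `{t | 0 < t ∧ x j ≤ t ∧ (j + 1 < N → t < x (j + 1))}`.
[folklore] -/
theorem window_card_le (ι : Type) [Fintype ι] [DecidableEq ι] (d : Fin K → ℕ) (S : Fin K → Matrix ι ι ℝ)
    (hS : ∀ l, (S l).IsSymm) (N : ℕ) (x : ℕ → ℝ) (hxmono : Monotone x)
    (hxpos : ∀ j, 1 ≤ j → 0 < x j) (j : ℕ) (w : ℝ → ℝ)
    (hw : ∀ u ∈ ({t : ℝ | 0 < t ∧ x j ≤ t ∧ (j + 1 < N → t ≤ x (j + 1))} : Set ℝ), 0 < w u)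
    (hmono : (∀ s t : ℝ, s ∈ ({t : ℝ | 0 < t ∧ x j ≤ t ∧ (j + 1 < N → t ≤ x (j + 1))} : Set ℝ) →
        t ∈ ({t : ℝ | 0 < t ∧ x j ≤ t ∧ (j + 1 < N → t ≤ x (j + 1))} : Set ℝ) → s ≤ t →
        (((w t)⁻¹ • ∑ l, (t ^ d l) • S l) - ((w s)⁻¹ • ∑ l, (s ^ d l) • S l)).PosSemidef) ∨
      (∀ s t : ℝ, s ∈ ({t : ℝ | 0 < t ∧ x j ≤ t ∧ (j + 1 < N → t ≤ x (j + 1))} : Set ℝ) →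
        t ∈ ({t : ℝ | 0 < t ∧ x j ≤ t ∧ (j + 1 < N → t ≤ x (j + 1))} : Set ℝ) → s ≤ t →
        (((w s)⁻¹ • ∑ l, (s ^ d l) • S l) - ((w t)⁻¹ • ∑ l, (t ^ d l) • S l)).PosSemidef)) :
    ((Matrix.det (∑ l, ((Polynomial.X : Polynomial ℝ) ^ d l) • (S l).map Polynomial.C)
        ).roots.toFinset.filter (fun t => 0 < t ∧ x j ≤ t ∧ (j + 1 < N → t < x (j + 1)))).card
      ≤ Fintype.card ι := by
  rcases hmono with hup | hdown
  · exact RegimeWindows.posRoots_window_le ι d S hS w _ (window_ordConnected N x j)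
      (fun u hu => hu.1) hw hup _ (clamp_mono N x j)
      (fun u hu => clamp_mem N x hxmono hxpos j hu) _
      (fun t ht => ⟨ht.1, ht.2.1, fun h => (ht.2.2 h).le⟩) (fun t s ht hts => lt_clamp N x j ht hts)
      (fun t ht => clamp_fix N x j ht)
  · have h := RegimeWindows.posRoots_window_le ι d (fun l => -S l) (fun l => (hS l).neg) w _
      (window_ordConnected N x j) (fun u hu => hu.1) hw
      (fun s t hs ht hst => RegimeWindows.anti_to_mono d S w s t (hdown s t hs ht hst))
      _ (clamp_mono N x j) (fun u hu => clamp_mem N x hxmono hxpos j hu)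
      (fun t => 0 < t ∧ x j ≤ t ∧ (j + 1 < N → t < x (j + 1)))
      (fun t ht => ⟨ht.1, ht.2.1, fun h => (ht.2.2 h).le⟩) (fun t s ht hts => lt_clamp N x j ht hts)
      (fun t ht => clamp_fix N x j ht)
    rwa [roots_det_pencil_neg d S] at h

/-- Every positive real lies in the designated region of some window `j < N` (`N ≥ 1`, `x 0 = 0`). [folklore] -/
theorem exists_window (N : ℕ) (hN : 1 ≤ N) (x : ℕ → ℝ) (hx0 : x 0 = 0) {t : ℝ} (ht : 0 < t) :
    ∃ j, j < N ∧ (0 < t ∧ x j ≤ t ∧ (j + 1 < N → t < x (j + 1))) := by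
  classical
  set J := (Finset.range N).filter (fun j => x j ≤ t) with hJ
  have h0 : 0 ∈ J := Finset.mem_filter.2 ⟨Finset.mem_range.2 (by omega), by rw [hx0]; exact ht.le⟩
  have hne : J.Nonempty := ⟨0, h0⟩
  refine ⟨J.max' hne, Finset.mem_range.1 (Finset.mem_filter.1 (J.max'_mem hne)).1, ht,
    (Finset.mem_filter.1 (J.max'_mem hne)).2, fun h => ?_⟩
  by_contra hle
  push Not at hle
  have hmem : J.max' hne + 1 ∈ J := Finset.mem_filter.2 ⟨Finset.mem_range.2 h, hle⟩
  have := J.le_max' _ hmem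
  omega

end ManyWindows

/-- **N REGIME WINDOWS ⇒ `Z₊ ≤ N·card ι`.**  Breakpoints `x : ℕ → ℝ` with `x 0 = 0`, `x` monotone and `x j > 0`
for `j ≥ 1`; windows `Wⱼ = {t > 0 : x j ≤ t (≤ x (j+1) if j+1 < N)}`, `j < N` (`N ≥ 1`).  If for every `j < N` some
weight `wⱼ > 0` on `Wⱼ` makes `u ↦ wⱼ(u)⁻¹ • F(u)` Loewner non-decreasing on `Wⱼ` OR Loewner non-increasing on `Wⱼ`,
then `det (∑ₗ X^{dₗ} Sₗ)` has at most `N·card ι` distinct positive zeros.  [folklore] -/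
theorem manyWindows_posRoots_le (ι : Type) [Fintype ι] [DecidableEq ι] {K : ℕ} (d : Fin K → ℕ)
    (S : Fin K → Matrix ι ι ℝ) (hS : ∀ l, (S l).IsSymm) (N : ℕ) (hN : 1 ≤ N) (x : ℕ → ℝ) (hxmono : Monotone x)
    (hx0 : x 0 = 0) (hxpos : ∀ j, 1 ≤ j → 0 < x j) (w : ℕ → ℝ → ℝ)
    (hw : ∀ j, j < N → ∀ u ∈ ({t : ℝ | 0 < t ∧ x j ≤ t ∧ (j + 1 < N → t ≤ x (j + 1))} : Set ℝ), 0 < w j u)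
    (hmono : ∀ j, j < N →
      (∀ s t : ℝ, s ∈ ({t : ℝ | 0 < t ∧ x j ≤ t ∧ (j + 1 < N → t ≤ x (j + 1))} : Set ℝ) →
        t ∈ ({t : ℝ | 0 < t ∧ x j ≤ t ∧ (j + 1 < N → t ≤ x (j + 1))} : Set ℝ) → s ≤ t →
        (((w j t)⁻¹ • ∑ l, (t ^ d l) • S l) - ((w j s)⁻¹ • ∑ l, (s ^ d l) • S l)).PosSemidef) ∨
      (∀ s t : ℝ, s ∈ ({t : ℝ | 0 < t ∧ x j ≤ t ∧ (j + 1 < N → t ≤ x (j + 1))} : Set ℝ) →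
        t ∈ ({t : ℝ | 0 < t ∧ x j ≤ t ∧ (j + 1 < N → t ≤ x (j + 1))} : Set ℝ) → s ≤ t →
        (((w j s)⁻¹ • ∑ l, (s ^ d l) • S l) - ((w j t)⁻¹ • ∑ l, (t ^ d l) • S l)).PosSemidef)) :
    ((Matrix.det (∑ l, ((Polynomial.X : Polynomial ℝ) ^ d l) • (S l).map Polynomial.C)
        ).roots.toFinset.filter (fun t => 0 < t)).card ≤ N * Fintype.card ι := by
  classical
  set P := Matrix.det (∑ l, ((Polynomial.X : Polynomial ℝ) ^ d l) • (S l).map Polynomial.C)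
    with hPdef
  have hwin : ∀ j ∈ Finset.range N,
      (P.roots.toFinset.filter (fun t => 0 < t ∧ x j ≤ t ∧ (j + 1 < N → t < x (j + 1)))).card
        ≤ Fintype.card ι := by
    intro j hj
    exact ManyWindows.window_card_le ι d S hS N x hxmono hxpos j (w j)
      (hw j (Finset.mem_range.1 hj)) (hmono j (Finset.mem_range.1 hj))
  have hsub : P.roots.toFinset.filter (fun t => 0 < t)
      ⊆ (Finset.range N).biUnion
          (fun j => P.roots.toFinset.filter (fun t => 0 < t ∧ x j ≤ t ∧ (j + 1 < N → t < x (j + 1)))) := by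
    intro t ht
    rw [Finset.mem_filter] at ht
    obtain ⟨j, hjN, hj⟩ := ManyWindows.exists_window N hN x hx0 ht.2
    rw [Finset.mem_biUnion]
    exact ⟨j, Finset.mem_range.2 hjN, Finset.mem_filter.2 ⟨ht.1, hj⟩⟩
  calc (P.roots.toFinset.filter (fun t => 0 < t)).card
      ≤ ((Finset.range N).biUnion
          (fun j => P.roots.toFinset.filter (fun t => 0 < t ∧ x j ≤ t ∧ (j + 1 < N → t < x (j + 1))))).card :=
        Finset.card_le_card hsub
    _ ≤ ∑ j ∈ Finset.range N,
          (P.roots.toFinset.filter (fun t => 0 < t ∧ x j ≤ t ∧ (j + 1 < N → t < x (j + 1)))).card :=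
        Finset.card_biUnion_le
    _ ≤ ∑ j ∈ Finset.range N, Fintype.card ι := Finset.sum_le_sum hwin
    _ = N * Fintype.card ι := by rw [Finset.sum_const, Finset.card_range, smul_eq_mul]

end Summit.ValiantsHypothesis.ValiantsHypothesis.Theorems.LacunarySymmetroidMatrixDescartes
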